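import Mathlib
import HarnessLib
import Literature.Computability.AlgebraicComplexity.BDI20ColouringGadgets
import Literature.Computability.AlgebraicComplexity.BDI20GridLikeLayeredGraphs
import Literature.Computability.AlgebraicComplexity.BDI20EightRegularisationDegrees

/-!
# BDI20 §8, Lemma 29 (= Lemma 26, second half): the replaced graph IS a grid-like layered `8`-regular
# multigraph — GEOMETRIC LAYER (Def. 24 for the parity-mirrored placement) and the packaged statement

M. Bläser, J. Dörfler, C. Ikenmeyer, *On the complexity of evaluating highest weight vectors*,
arXiv:2002.11594 (= CCC 2021, LIPIcs 200:29), §8. TeX of record `HOME/lit/src/2002.11594/fullversion.tex`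
(sha16 9e732dfe87cd0d83): Def. 24 `def:gridlike` L1665–1678 (items (1) injective embedding, (3) edges
between consecutive layers only, (4) edges inside a layer only between `e(u) ± (1,0)`, (5) straight-line
planarity, (6) every vertex has a neighbour in another layer); Lemma 26 proof L1925–1926 ("Secondly all
those gadgets are designed as grid-like layered graphs. It can be easily checked that replacing all edges
in a subgraph of a grid yields a grid-like layered graph, so `G_2` is grid-like layered.") and L1927–1932
(`8`-regularisation); Lemma 29 `lem:gridlikeethhardness` L2272–2283 ("… the obtained graph `G_2` now has
`O(|V(G)|)` many vertices. If we can decide whether the `8`-regular grid-like layered graph `G_2` allows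
for a proper `3`-coloring … we can decide via this reduction whether `G` allows for a relational
`3`-coloring"). Numbering: arXiv flat (CCC 2021 in brackets): Def. 24 [8.3], Lemma 26 [8.5], Lemma 29
[8.8]. Cell val-lit, typer t20 g10; FILE D part 2 of the §8 programme (`HOME/np/MEMO-t21g11-BDI20-sec8-
gadgets.md`, lead-np RULING (124), closer-owner x6 g8's `HOME/np/NOTE-x6g8-BDI20-sec8-LAYOUT.md`). Part 1
`BDI20EightRegularisationDegrees.lean` (p549458) supplies the vertex set `W` / `Fin card₂`, the
closed-form `mult`/`mult₂`, `posW`/`pos₂`, the `8`-regularity and the colouring equivalence; FILE A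
`BDI20GridLikeLayeredGraphs.lean` supplies `GridLikeLayered`, `RelGridGraph`; FILE B
`BDI20ColouringGadgets.lean` the gadget drawings. HONEST FRAMING: layout bookkeeping of an NP- and
ETH-hardness reduction about EVALUATING highest weight vectors; nothing here bears on `VP` versus `VNP`,
which is NOT proved.

## What the source prints and how it is rendered

* **"replacing all edges in a subgraph of a grid yields a grid-like layered graph"** (L1925–1926) is
  PROVED for the placement `posW` of part 1 — ports at `4·e_H + (2,2)`, gadgets placed by the PARITY
  MIRRORING rule (registry B47: the placement as literally drawn is NOT injective at a vertex with a
  rightward and an upward edge; mirroring each gadget by the parity of its lower end repairs this — an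
  unprinted rule, disclosed): `posW_injective` (Def. 24 (1): mod-`4` classes separate ports / horizontal
  inner / vertical inner vertices, and `place_eq_place` separates a horizontal bump from a vertical bump
  by the parity rule — pure `omega` arithmetic), `adj_geometry_W` (Def. 24 (3), (4): every edge lies in
  one gadget, whose drawing is locally correct, `localOK_tables`, transported through the reflecting
  placement, `place_geometry`), `noncrossing_W` (Def. 24 (5) in FILE A's combinatorial rendering:
  inside one gadget by the table fact `nc_tables` = FILE B's `layerEdgesNonCrossing` in a
  reflection-invariant form, `place_noncross_same`; across two gadgets by `place_noncross_distinct` —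
  edges have `|Δx| ≤ 1`, distinct gadgets of equal orientation are `≥ 4` apart, and a horizontal and a
  vertical gadget at a common corner are kept apart by the parity rule, again pure arithmetic),
  `exists_inter_W` (Def. 24 (6): `layerNeighbour_tables`); the local facts about the four drawings are
  kernel-checked by `decide` on the offset tables `offEqH/offEqV/offNeH/offNeV` (= FILE B's positions
  minus `(1,1)`), via the normal forms `posW_attachEq/Ne` and `pos_hi_eq` (the upper end of an edge is the
  right / top unit neighbour of the lower end).
* **★ `regularise H hiso hs : GridLikeLayered H.card₂`** — Lemma 29's `G₂` packaged in FILE A's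
  vocabulary (so FILE A's Lemma 25 `interCols`/`intraCols` apply to it), with `regularise_pos = pos₂`,
  `regularise_mult = mult₂` (`rfl`, the closed forms of part 1), ★ `regularise_isRegular : IsRegular 8`,
  ★ `regularise_isProper3_iff : (∃ c, IsProper3 c) ↔ H.IsRelColourable`, `card₂_le : card₂ ≤ 13·N`
  (part 1). Hypotheses (discharged by the instance, x6's crossbar `C′`): `NoIsolated` (every vertex
  of `H` on an edge — also forced by Def. 24 (6)), `EdgesSimple` (no edge both equality and inequality).

Nothing in this file is a conjecture or a named fact; no `instance`, no notation; the heavy arithmetic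
lemmas run under raised `maxHeartbeats` / `synthInstance` / `maxRecDepth` options (kernel-checked
`decide` over the gadget tables, `omega` over the sign cases of the placement).

## References
* [BlaserDorflerIkenmeyer2020] M. Bläser, J. Dörfler, C. Ikenmeyer, *On the complexity of evaluating
  highest weight vectors*, arXiv:2002.11594 / CCC 2021 — Def. 24 (TeX L1665–1678), Lemma 26 proof
  (L1917–1932), Lemma 29 (L2272–2283).
-/

namespace Literature.Computability.AlgebraicComplexity

namespace BDI2020

open Gadgets

namespace RelGridGraph

variable {N : ℕ} (H : RelGridGraph N)

/-! ## Geometry of an edge of `H`: the upper end is the right / top neighbour of the lower end -/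

/-- The upper end of a gadget's edge is the unit right neighbour (horizontal edge) or the unit top
neighbour (vertical edge) of the lower end. [cite: BlaserDorflerIkenmeyer2020, Lemma 26, proof ("If an edge is horizontal … variant 1. If an edge is vertical … variant 2") (arXiv, TeX L1919–1920; = CCC 2021 Lemma 8.5)] -/
theorem pos_hi_eq (g : H.GIdx) :
    (H.isHor g = true ∧ H.pos (H.hi g) = ((H.pos (H.lo g)).1 + 1, (H.pos (H.lo g)).2)) ∨
      (H.isHor g = false ∧ H.pos (H.hi g) = ((H.pos (H.lo g)).1, (H.pos (H.lo g)).2 + 1)) := by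
  have hadj : GridAdjacent (H.pos (H.edgeOf g).1) (H.pos (H.edgeOf g).2) := by
    rcases g with j | j
    · exact H.eqAdj_grid _ _ (H.eqAdj_edgeOf j)
    · exact H.neAdj_grid _ _ (H.neAdj_edgeOf j)
  unfold GridAdjacent at hadj
  unfold lo hi isHor
  by_cases hle : (H.pos (H.edgeOf g).1).1 + (H.pos (H.edgeOf g).1).2 ≤
      (H.pos (H.edgeOf g).2).1 + (H.pos (H.edgeOf g).2).2
  · simp only [hle, ↓reduceIte, decide_eq_true_eq, decide_eq_false_iff_not, Prod.ext_iff]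
    omega
  · simp only [hle, ↓reduceIte, decide_eq_true_eq, decide_eq_false_iff_not, Prod.ext_iff]
    omega

/-! ## Normal form of the embedding on attached vertices -/

/-- The local offset table of the equality gadget `j` (variant by direction).
[cite: BlaserDorflerIkenmeyer2020, Lemma 26, Fig. eqneqgadget (arXiv; = CCC 2021 Lemma 8.5)] -/
def offEq (j : Fin H.numEq) : Fin 7 → ℕ × ℕ := if H.isHor (Sum.inl j) then offEqH else offEqV

/-- The local offset table of the inequality gadget `j`. [cite: BlaserDorflerIkenmeyer2020, Lemma 26, Fig. eqneqgadget (arXiv; = CCC 2021 Lemma 8.5)] -/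
def offNe (j : Fin H.numNe) : Fin 8 → ℕ × ℕ := if H.isHor (Sum.inr j) then offNeH else offNeV

/-- The embedding places every local vertex of an equality gadget by `place`.
[cite: BlaserDorflerIkenmeyer2020, Lemma 26, proof (arXiv, TeX L1925–1926; = CCC 2021 Lemma 8.5)] -/
theorem posW_attachEq (j : Fin H.numEq) (a : Fin 7) :
    H.posW (H.attachEq j a) = H.place (Sum.inl j) (H.offEq j a) := by
  rcases H.pos_hi_eq (Sum.inl j) with ⟨hh, hq⟩ | ⟨hh, hq⟩
  · by_cases h0 : a = 0
    · subst h0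
      simp [attachEq, posW, place, offEq, hh, offEqH, scalePos]
    by_cases h6 : a = 6
    · subst h6
      simp only [attachEq_six, posW, hq, scalePos, place, offEq, hh, ↓reduceIte, offEqH]
      split_ifs <;> (simp [Prod.mk.injEq]; omega)
    · have h0' : a.1 ≠ 0 := fun h => h0 (Fin.ext h)
      have h6' : a.1 ≠ 6 := fun h => h6 (Fin.ext h)
      have ha : (⟨a.1 - 1 + 1, by omega⟩ : Fin 7) = a :=
        Fin.ext (Nat.sub_add_cancel (Nat.one_le_iff_ne_zero.2 h0'))
      simp only [attachEq, h0', ↓reduceIte, h6', ↓reduceDIte, posW, offEq, hh, ha]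
  · by_cases h0 : a = 0
    · subst h0
      simp [attachEq, posW, place, offEq, hh, offEqV, scalePos]
    by_cases h6 : a = 6
    · subst h6
      simp only [attachEq_six, posW, hq, scalePos, place, offEq, hh, ↓reduceIte, offEqV,
        Bool.false_eq_true]
      split_ifs <;> (simp [Prod.mk.injEq]; omega)
    · have h0' : a.1 ≠ 0 := fun h => h0 (Fin.ext h)
      have h6' : a.1 ≠ 6 := fun h => h6 (Fin.ext h)
      have ha : (⟨a.1 - 1 + 1, by omega⟩ : Fin 7) = a :=
        Fin.ext (Nat.sub_add_cancel (Nat.one_le_iff_ne_zero.2 h0'))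
      simp only [attachEq, h0', ↓reduceIte, h6', ↓reduceDIte, posW, offEq, hh, ha, Bool.false_eq_true]

/-- The embedding places every local vertex of an inequality gadget by `place`.
[cite: BlaserDorflerIkenmeyer2020, Lemma 26, proof (arXiv, TeX L1925–1926; = CCC 2021 Lemma 8.5)] -/
theorem posW_attachNe (j : Fin H.numNe) (a : Fin 8) :
    H.posW (H.attachNe j a) = H.place (Sum.inr j) (H.offNe j a) := by
  rcases H.pos_hi_eq (Sum.inr j) with ⟨hh, hq⟩ | ⟨hh, hq⟩
  · by_cases h0 : a = 0
    · subst h0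
      simp [attachNe, posW, place, offNe, hh, offNeH, scalePos]
    by_cases h7 : a = 7
    · subst h7
      simp only [attachNe_seven, posW, hq, scalePos, place, offNe, hh, ↓reduceIte, offNeH]
      split_ifs <;> (simp [Prod.mk.injEq]; omega)
    · have h0' : a.1 ≠ 0 := fun h => h0 (Fin.ext h)
      have h7' : a.1 ≠ 7 := fun h => h7 (Fin.ext h)
      have ha : (⟨a.1 - 1 + 1, by omega⟩ : Fin 8) = a :=
        Fin.ext (Nat.sub_add_cancel (Nat.one_le_iff_ne_zero.2 h0'))
      simp only [attachNe, h0', ↓reduceIte, h7', ↓reduceDIte, posW, offNe, hh, ha]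
  · by_cases h0 : a = 0
    · subst h0
      simp [attachNe, posW, place, offNe, hh, offNeV, scalePos]
    by_cases h7 : a = 7
    · subst h7
      simp only [attachNe_seven, posW, hq, scalePos, place, offNe, hh, ↓reduceIte, offNeV,
        Bool.false_eq_true]
      split_ifs <;> (simp [Prod.mk.injEq]; omega)
    · have h0' : a.1 ≠ 0 := fun h => h0 (Fin.ext h)
      have h7' : a.1 ≠ 7 := fun h => h7 (Fin.ext h)
      have ha : (⟨a.1 - 1 + 1, by omega⟩ : Fin 8) = a :=
        Fin.ext (Nat.sub_add_cancel (Nat.one_le_iff_ne_zero.2 h0'))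
      simp only [attachNe, h0', ↓reduceIte, h7', ↓reduceDIte, posW, offNe, hh, ha, Bool.false_eq_true]

/-! ## Local (kernel-checked) facts about the four gadget drawings -/

/-- The local shape of an edge of a drawn gadget: ends in different rows are in consecutive rows, ends
in one row are horizontal neighbours (Def. 24 (3), (4) inside a gadget).
[cite: BlaserDorflerIkenmeyer2020, Def. 24 (3), (4) and Lemma 26, proof ("all those gadgets are designed as grid-like layered graphs") (arXiv, TeX L1671–1672, L1925; = CCC 2021 Def. 8.3, Lemma 8.5)] -/
abbrev LocalOK (o o' : ℕ × ℕ) : Prop :=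
  (o.2 ≠ o'.2 → (o'.2 = o.2 + 1 ∨ o.2 = o'.2 + 1) ∧ o'.1 ≤ o.1 + 1 ∧ o.1 ≤ o'.1 + 1) ∧
    (o.2 = o'.2 → (o'.1 = o.1 + 1 ∨ o.1 = o'.1 + 1))

/-- `LocalOK` is symmetric. [folklore] -/
private theorem localOK_symm {o o' : ℕ × ℕ} (h : LocalOK o o') : LocalOK o' o := by
  unfold LocalOK at *; omega

/-- The drawn gadgets satisfy Def. 24 (3), (4) edge by edge. [cite: BlaserDorflerIkenmeyer2020, Lemma 26, proof (arXiv, TeX L1925; = CCC 2021 Lemma 8.5)] -/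
private theorem localOK_tables :
    (∀ e ∈ eqGadgetH.edges, LocalOK (offEqH e.1) (offEqH e.2)) ∧
    (∀ e ∈ eqGadgetV.edges, LocalOK (offEqV e.1) (offEqV e.2)) ∧
    (∀ e ∈ neGadgetH.edges, LocalOK (offNeH e.1) (offNeH e.2)) ∧
    (∀ e ∈ neGadgetV.edges, LocalOK (offNeV e.1) (offNeV e.2)) := by
  refine ⟨?_, ?_, ?_, ?_⟩ <;> decide

/-- Bounds of the offset tables (horizontal: bumps one row off the axis; vertical: one column).
[cite: BlaserDorflerIkenmeyer2020, Lemma 26, Fig. eqneqgadget (arXiv; = CCC 2021 Lemma 8.5)] -/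
private theorem bounds_tables :
    (∀ i, (offEqH i).1 ≤ 4 ∧ (offEqH i).2 ≤ 1) ∧ (∀ i, (offEqV i).1 ≤ 1 ∧ (offEqV i).2 ≤ 4) ∧
    (∀ i, (offNeH i).1 ≤ 4 ∧ (offNeH i).2 ≤ 1) ∧ (∀ i, (offNeV i).1 ≤ 1 ∧ (offNeV i).2 ≤ 4) := by
  refine ⟨?_, ?_, ?_, ?_⟩ <;> decide

/-- Every local vertex of a drawn gadget lies on an edge to another row (Def. 24 (6) inside a gadget,
ports included). [cite: BlaserDorflerIkenmeyer2020, Def. 24 (6) and Lemma 26, proof (arXiv, TeX L1674, L1925; = CCC 2021 Def. 8.3, Lemma 8.5)] -/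
private theorem layerNeighbour_tables :
    (∀ i : Fin 7, ∃ e ∈ eqGadgetH.edges, (e.1 = i ∨ e.2 = i) ∧ (offEqH e.1).2 ≠ (offEqH e.2).2) ∧
    (∀ i : Fin 7, ∃ e ∈ eqGadgetV.edges, (e.1 = i ∨ e.2 = i) ∧ (offEqV e.1).2 ≠ (offEqV e.2).2) ∧
    (∀ i : Fin 8, ∃ e ∈ neGadgetH.edges, (e.1 = i ∨ e.2 = i) ∧ (offNeH e.1).2 ≠ (offNeH e.2).2) ∧
    (∀ i : Fin 8, ∃ e ∈ neGadgetV.edges, (e.1 = i ∨ e.2 = i) ∧ (offNeV e.1).2 ≠ (offNeV e.2).2) := by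
  refine ⟨?_, ?_, ?_, ?_⟩ <;> decide

/-- The edges of the equality gadget `j` are locally well drawn. [cite: BlaserDorflerIkenmeyer2020, Lemma 26, proof (arXiv, TeX L1925; = CCC 2021 Lemma 8.5)] -/
theorem localOK_offEq (j : Fin H.numEq) {a b : Fin 7} (h : (a, b) ∈ H.edgesEq j) :
    LocalOK (H.offEq j a) (H.offEq j b) := by
  obtain ⟨h1, h2, -, -⟩ := localOK_tables
  unfold edgesEq at h; unfold offEq
  split_ifs at h ⊢ with hh
  · exact h1 _ h
  · exact h2 _ h

/-- The edges of the inequality gadget `j` are locally well drawn. [cite: BlaserDorflerIkenmeyer2020, Lemma 26, proof (arXiv, TeX L1925; = CCC 2021 Lemma 8.5)] -/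
theorem localOK_offNe (j : Fin H.numNe) {a b : Fin 8} (h : (a, b) ∈ H.edgesNe j) :
    LocalOK (H.offNe j a) (H.offNe j b) := by
  obtain ⟨-, -, h3, h4⟩ := localOK_tables
  unfold edgesNe at h; unfold offNe
  split_ifs at h ⊢ with hh
  · exact h3 _ h
  · exact h4 _ h

/-- Offset bounds of the equality gadget `j` by orientation. [cite: BlaserDorflerIkenmeyer2020, Lemma 26, Fig. eqneqgadget (arXiv; = CCC 2021 Lemma 8.5)] -/
theorem bounds_offEq (j : Fin H.numEq) (a : Fin 7) :
    (H.offEq j a).1 ≤ 4 ∧ (H.offEq j a).2 ≤ 4 ∧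
      ((H.isHor (Sum.inl j) = true ∧ (H.offEq j a).2 ≤ 1) ∨
        (H.isHor (Sum.inl j) = false ∧ (H.offEq j a).1 ≤ 1)) := by
  obtain ⟨h1, h2, -, -⟩ := bounds_tables
  unfold offEq
  cases hh : H.isHor (Sum.inl j)
  · have := h2 a
    simp only [Bool.false_eq_true, ↓reduceIte, false_and, true_and, false_or]; omega
  · have := h1 a
    simp only [↓reduceIte, true_and, Bool.true_eq_false, false_and, or_false]; omega

/-- Offset bounds of the inequality gadget `j` by orientation. [cite: BlaserDorflerIkenmeyer2020, Lemma 26, Fig. eqneqgadget (arXiv; = CCC 2021 Lemma 8.5)] -/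
theorem bounds_offNe (j : Fin H.numNe) (a : Fin 8) :
    (H.offNe j a).1 ≤ 4 ∧ (H.offNe j a).2 ≤ 4 ∧
      ((H.isHor (Sum.inr j) = true ∧ (H.offNe j a).2 ≤ 1) ∨
        (H.isHor (Sum.inr j) = false ∧ (H.offNe j a).1 ≤ 1)) := by
  obtain ⟨-, -, h3, h4⟩ := bounds_tables
  unfold offNe
  cases hh : H.isHor (Sum.inr j)
  · have := h4 a
    simp only [Bool.false_eq_true, ↓reduceIte, false_and, true_and, false_or]; omega
  · have := h3 a
    simp only [↓reduceIte, true_and, Bool.true_eq_false, false_and, or_false]; omega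

/-- **Transport through the placement:** rows and columns of two local vertices of one gadget relate as
their offsets do (the placement is a translation composed with axis reflections that never leave
`ℕ × ℕ`). [cite: BlaserDorflerIkenmeyer2020, Lemma 26, proof (arXiv, TeX L1925–1926; = CCC 2021 Lemma 8.5)] -/
theorem place_geometry (g : H.GIdx) {o o' : ℕ × ℕ}
    (ho : o.1 ≤ 4 ∧ o.2 ≤ 4 ∧ ((H.isHor g = true ∧ o.2 ≤ 1) ∨ (H.isHor g = false ∧ o.1 ≤ 1)))
    (ho' : o'.1 ≤ 4 ∧ o'.2 ≤ 4 ∧ ((H.isHor g = true ∧ o'.2 ≤ 1) ∨ (H.isHor g = false ∧ o'.1 ≤ 1))) :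
    (((H.place g o).2 = (H.place g o').2 ↔ o.2 = o'.2) ∧
      ((H.place g o').2 = (H.place g o).2 + 1 ∨ (H.place g o).2 = (H.place g o').2 + 1 ↔
        o'.2 = o.2 + 1 ∨ o.2 = o'.2 + 1)) ∧
    (((H.place g o).1 = (H.place g o').1 ↔ o.1 = o'.1) ∧
      ((H.place g o').1 = (H.place g o).1 + 1 ∨ (H.place g o).1 = (H.place g o').1 + 1 ↔
        o'.1 = o.1 + 1 ∨ o.1 = o'.1 + 1) ∧
      ((H.place g o).1 < (H.place g o').1 ↔
        ((H.isHor g = false ∧ H.parity g = 0) ∧ o'.1 < o.1) ∨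
          (¬ (H.isHor g = false ∧ H.parity g = 0) ∧ o.1 < o'.1))) := by
  unfold place scalePos
  cases hh : H.isHor g <;>
    simp only [hh, Bool.false_eq_true, Bool.true_eq_false, false_and, true_and, false_or, or_false]
      at ho ho' <;>
    by_cases hp : H.parity g = 0 <;>
    simp only [hp, Bool.false_eq_true, Bool.true_eq_false, ↓reduceIte, true_and, false_and, and_true,
      not_true_eq_false, not_false_eq_true, false_or, or_false] <;>
    omega

/-- **Def. 24 (3) and (4) for `G₂`:** an edge of positive multiplicity joins consecutive rows, or
horizontal neighbours of one row. [cite: BlaserDorflerIkenmeyer2020, Def. 24 (3), (4) and Lemma 26, proof ("replacing all edges in a subgraph of a grid yields a grid-like layered graph") (arXiv, TeX L1671–1672, L1925–1926; = CCC 2021 Def. 8.3, Lemma 8.5)] -/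
theorem adj_geometry_W {w w' : H.W} (h : 0 < H.mult w w') :
    ((H.posW w).2 ≠ (H.posW w').2 →
        ((H.posW w').2 = (H.posW w).2 + 1 ∨ (H.posW w).2 = (H.posW w').2 + 1)) ∧
    ((H.posW w).2 = (H.posW w').2 →
        ((H.posW w').1 = (H.posW w).1 + 1 ∨ (H.posW w).1 = (H.posW w').1 + 1)) := by
  rcases H.exists_attach_of_mult_pos h with ⟨j, a, b, rfl, rfl, hab⟩ | ⟨j, a, b, rfl, rfl, hab⟩
  · rw [posW_attachEq, posW_attachEq]
    have hOK : LocalOK (H.offEq j a) (H.offEq j b) := by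
      rcases (H.multEq_pos_iff j a b).1 hab with he | he
      · exact H.localOK_offEq j he
      · exact localOK_symm (H.localOK_offEq j he)
    obtain ⟨⟨e1, e2⟩, e3, e4, -⟩ := H.place_geometry (Sum.inl j) (H.bounds_offEq j a) (H.bounds_offEq j b)
    unfold LocalOK at hOK
    constructor
    · intro hne; exact e2.2 (hOK.1 (fun h => hne (e1.2 h))).1
    · intro heq; exact e4.2 (hOK.2 (e1.1 heq))
  · rw [posW_attachNe, posW_attachNe]
    have hOK : LocalOK (H.offNe j a) (H.offNe j b) := by
      rcases (H.multNe_pos_iff j a b).1 hab with he | he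
      · exact H.localOK_offNe j he
      · exact localOK_symm (H.localOK_offNe j he)
    obtain ⟨⟨e1, e2⟩, e3, e4, -⟩ := H.place_geometry (Sum.inr j) (H.bounds_offNe j a) (H.bounds_offNe j b)
    unfold LocalOK at hOK
    constructor
    · intro hne; exact e2.2 (hOK.1 (fun h => hne (e1.2 h))).1
    · intro heq; exact e4.2 (hOK.2 (e1.1 heq))

/-- Every vertex of `G₂` is a local vertex of some gadget (ports: of any gadget at them).
[cite: BlaserDorflerIkenmeyer2020, Lemma 26, proof (arXiv, TeX L1917–1919; = CCC 2021 Lemma 8.5)] -/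
theorem exists_attach (hiso : H.NoIsolated) (w : H.W) :
    (∃ j a, w = H.attachEq j a) ∨ (∃ j a, w = H.attachNe j a) := by
  rcases w with v | ⟨⟨j, i⟩⟩ | ⟨⟨j, i⟩⟩
  · have hne : (Finset.univ.filter fun g : H.GIdx => H.MemG g v).Nonempty :=
      Finset.card_pos.1 (H.one_le_incCount hiso v)
    obtain ⟨g, hg⟩ := hne
    have hm : H.MemG g v := by simpa using hg
    rcases g with j | j
    · left
      rcases hm with h | h
      · exact ⟨j, 0, by rw [attachEq_zero, h]⟩
      · exact ⟨j, 6, by rw [attachEq_six, h]⟩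
    · right
      rcases hm with h | h
      · exact ⟨j, 0, by rw [attachNe_zero, h]⟩
      · exact ⟨j, 7, by rw [attachNe_seven, h]⟩
  · exact Or.inl ⟨j, ⟨i.1 + 1, by omega⟩, H.eq_attachEq_of_idxEq (by simp [idxEq])⟩
  · exact Or.inr ⟨j, ⟨i.1 + 1, by omega⟩, H.eq_attachNe_of_idxNe (by simp [idxNe])⟩

/-- **Def. 24 (6) for `G₂`:** every vertex has a neighbour in a different row.
[cite: BlaserDorflerIkenmeyer2020, Def. 24 (6) and Lemma 26, proof (arXiv, TeX L1674, L1925–1926; = CCC 2021 Def. 8.3, Lemma 8.5)] -/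
theorem exists_inter_W (hiso : H.NoIsolated) (w : H.W) :
    ∃ w', 0 < H.mult w w' ∧ (H.posW w').2 ≠ (H.posW w).2 := by
  obtain ⟨t1, t2, t3, t4⟩ := layerNeighbour_tables
  rcases H.exists_attach hiso w with ⟨j, a, rfl⟩ | ⟨j, a, rfl⟩
  · have hloc : ∃ e ∈ H.edgesEq j, (e.1 = a ∨ e.2 = a) ∧ (H.offEq j e.1).2 ≠ (H.offEq j e.2).2 := by
      unfold edgesEq offEq; cases H.isHor (Sum.inl j)
      · simpa using t2 a
      · simpa using t1 a
    obtain ⟨⟨e1, e2⟩, he, hea, hne⟩ := hloc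
    have key : ∀ b, ((a, b) ∈ H.edgesEq j ∨ (b, a) ∈ H.edgesEq j) →
        (H.offEq j a).2 ≠ (H.offEq j b).2 →
        ∃ w', 0 < H.mult (H.attachEq j a) w' ∧ (H.posW w').2 ≠ (H.posW (H.attachEq j a)).2 := by
      intro b hb hne'
      refine ⟨H.attachEq j b, ?_, ?_⟩
      · rw [mult_attachEq]; exact (H.multEq_pos_iff j a b).2 hb
      · rw [posW_attachEq, posW_attachEq]
        obtain ⟨⟨e1', -⟩, -⟩ := H.place_geometry (Sum.inl j) (H.bounds_offEq j a) (H.bounds_offEq j b)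
        exact fun h' => hne' (e1'.1 h'.symm)
    simp only at hea
    rcases hea with rfl | rfl
    · exact key e2 (Or.inl he) hne
    · exact key e1 (Or.inr he) (Ne.symm hne)
  · have hloc : ∃ e ∈ H.edgesNe j, (e.1 = a ∨ e.2 = a) ∧ (H.offNe j e.1).2 ≠ (H.offNe j e.2).2 := by
      unfold edgesNe offNe; cases H.isHor (Sum.inr j)
      · simpa using t4 a
      · simpa using t3 a
    obtain ⟨⟨e1, e2⟩, he, hea, hne⟩ := hloc
    have key : ∀ b, ((a, b) ∈ H.edgesNe j ∨ (b, a) ∈ H.edgesNe j) →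
        (H.offNe j a).2 ≠ (H.offNe j b).2 →
        ∃ w', 0 < H.mult (H.attachNe j a) w' ∧ (H.posW w').2 ≠ (H.posW (H.attachNe j a)).2 := by
      intro b hb hne'
      refine ⟨H.attachNe j b, ?_, ?_⟩
      · rw [mult_attachNe]; exact (H.multNe_pos_iff j a b).2 hb
      · rw [posW_attachNe, posW_attachNe]
        obtain ⟨⟨e1', -⟩, -⟩ := H.place_geometry (Sum.inr j) (H.bounds_offNe j a) (H.bounds_offNe j b)
        exact fun h' => hne' (e1'.1 h'.symm)
    simp only at hea
    rcases hea with rfl | rfl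
    · exact key e2 (Or.inl he) hne
    · exact key e1 (Or.inr he) (Ne.symm hne)

/-! ## Def. 24 (1): the embedding is injective (the parity rule at work) -/

/-- Inner vertices of the drawn gadgets: horizontal ones have abscissa offset `1..3` and ordinate
offset `≤ 1`; vertical ones the transpose. [cite: BlaserDorflerIkenmeyer2020, Lemma 26, Fig. eqneqgadget (arXiv; = CCC 2021 Lemma 8.5)] -/
private theorem inner_tables :
    (∀ i : Fin 7, i ≠ 0 → i ≠ 6 → 1 ≤ (offEqH i).1 ∧ (offEqH i).1 ≤ 3 ∧ (offEqH i).2 ≤ 1) ∧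
    (∀ i : Fin 7, i ≠ 0 → i ≠ 6 → (offEqV i).1 ≤ 1 ∧ 1 ≤ (offEqV i).2 ∧ (offEqV i).2 ≤ 3) ∧
    (∀ i : Fin 8, i ≠ 0 → i ≠ 7 → 1 ≤ (offNeH i).1 ∧ (offNeH i).1 ≤ 3 ∧ (offNeH i).2 ≤ 1) ∧
    (∀ i : Fin 8, i ≠ 0 → i ≠ 7 → (offNeV i).1 ≤ 1 ∧ 1 ≤ (offNeV i).2 ∧ (offNeV i).2 ≤ 3) := by
  refine ⟨?_, ?_, ?_, ?_⟩ <;> decide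

/-- The offset tables are injective. [cite: BlaserDorflerIkenmeyer2020, Lemma 26, Fig. eqneqgadget (arXiv; = CCC 2021 Lemma 8.5)] -/
private theorem injective_tables :
    (∀ i i' : Fin 7, offEqH i = offEqH i' → i = i') ∧ (∀ i i' : Fin 7, offEqV i = offEqV i' → i = i') ∧
    (∀ i i' : Fin 8, offNeH i = offNeH i' → i = i') ∧ (∀ i i' : Fin 8, offNeV i = offNeV i' → i = i') := by
  refine ⟨?_, ?_, ?_, ?_⟩ <;> decide

/-- An offset is INNER for gadget `g`: in the inner range of its orientation.
[cite: BlaserDorflerIkenmeyer2020, Lemma 26, Fig. eqneqgadget (arXiv; = CCC 2021 Lemma 8.5)] -/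
abbrev InnerOff (g : H.GIdx) (o : ℕ × ℕ) : Prop :=
  (H.isHor g = true ∧ 1 ≤ o.1 ∧ o.1 ≤ 3 ∧ o.2 ≤ 1) ∨ (H.isHor g = false ∧ o.1 ≤ 1 ∧ 1 ≤ o.2 ∧ o.2 ≤ 3)

/-- Inner local indices of an equality gadget have inner offsets. [cite: BlaserDorflerIkenmeyer2020, Lemma 26, Fig. eqneqgadget (arXiv; = CCC 2021 Lemma 8.5)] -/
theorem innerOff_offEq (j : Fin H.numEq) {a : Fin 7} (h0 : a ≠ 0) (h6 : a ≠ 6) :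
    H.InnerOff (Sum.inl j) (H.offEq j a) := by
  obtain ⟨t1, t2, -, -⟩ := inner_tables
  unfold InnerOff offEq
  cases hh : H.isHor (Sum.inl j)
  · have := t2 a h0 h6
    simp only [Bool.false_eq_true, ↓reduceIte, false_and, true_and, false_or]; omega
  · have := t1 a h0 h6
    simp only [↓reduceIte, true_and, Bool.true_eq_false, false_and, or_false]; omega

/-- Inner local indices of an inequality gadget have inner offsets. [cite: BlaserDorflerIkenmeyer2020, Lemma 26, Fig. eqneqgadget (arXiv; = CCC 2021 Lemma 8.5)] -/
theorem innerOff_offNe (j : Fin H.numNe) {a : Fin 8} (h0 : a ≠ 0) (h7 : a ≠ 7) :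
    H.InnerOff (Sum.inr j) (H.offNe j a) := by
  obtain ⟨-, -, t3, t4⟩ := inner_tables
  unfold InnerOff offNe
  cases hh : H.isHor (Sum.inr j)
  · have := t4 a h0 h7
    simp only [Bool.false_eq_true, ↓reduceIte, false_and, true_and, false_or]; omega
  · have := t3 a h0 h7
    simp only [↓reduceIte, true_and, Bool.true_eq_false, false_and, or_false]; omega

/-- **Two inner vertices at the same lattice point belong to gadgets of the same orientation with the
same lower end and have the same offset** — pure arithmetic: the mod-`4` classes separate everything
except a horizontal bump from a vertical bump, and those are separated by the PARITY rule.
[cite: BlaserDorflerIkenmeyer2020, Lemma 26, proof (TeX L1925–1926 «easily checked»; the placement rule of registry B47) (arXiv; = CCC 2021 Lemma 8.5)] -/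
theorem place_eq_place {g g' : H.GIdx} {o o' : ℕ × ℕ} (ho : H.InnerOff g o) (ho' : H.InnerOff g' o')
    (h : H.place g o = H.place g' o') :
    H.isHor g = H.isHor g' ∧ H.pos (H.lo g) = H.pos (H.lo g') ∧ o = o' := by
  unfold InnerOff at ho ho'
  unfold place scalePos parity at h
  rw [Prod.ext_iff] at h
  refine ⟨?_, Prod.ext ?_ ?_, Prod.ext ?_ ?_⟩ <;>
  cases hh : H.isHor g <;> cases hh' : H.isHor g' <;>
    simp only [hh, hh', Bool.false_eq_true, Bool.true_eq_false, false_and, true_and, false_or,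
      or_false, ↓reduceIte] at ho ho' h ⊢ <;>
    split_ifs at h <;> simp only at h <;> omega

/-- A port and an inner vertex never share a lattice point (ports are `≡ (2,2) mod 4`).
[cite: BlaserDorflerIkenmeyer2020, Lemma 26, proof (arXiv, TeX L1925–1926; = CCC 2021 Lemma 8.5)] -/
theorem scalePos_ne_place (p : ℕ × ℕ) {g : H.GIdx} {o : ℕ × ℕ} (ho : H.InnerOff g o) :
    scalePos p ≠ H.place g o := by
  intro h
  unfold InnerOff at ho
  unfold place scalePos parity at h
  rw [Prod.ext_iff] at h
  cases hh : H.isHor g <;>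
    simp only [hh, Bool.false_eq_true, Bool.true_eq_false, false_and, true_and, false_or, or_false,
      ↓reduceIte] at ho h <;>
    split_ifs at h <;> simp only at h <;> omega

/-- Gadgets with the same orientation and the same lower end are the same gadget.
[cite: BlaserDorflerIkenmeyer2020, Lemma 29, proof (arXiv, TeX L2278–2280; = CCC 2021 Lemma 8.8)] -/
theorem gadget_eq_of_lo (hs : H.EdgesSimple) {g g' : H.GIdx} (hh : H.isHor g = H.isHor g')
    (hlo : H.pos (H.lo g) = H.pos (H.lo g')) : g = g' := by
  have hl : H.lo g = H.lo g' := H.pos_injective hlo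
  have hhi : H.pos (H.hi g) = H.pos (H.hi g') := by
    rcases H.pos_hi_eq g with ⟨h1, h2⟩ | ⟨h1, h2⟩ <;> rcases H.pos_hi_eq g' with ⟨h1', h2'⟩ | ⟨h1', h2'⟩
    · rw [h2, h2', hlo]
    · rw [h1, h1'] at hh; exact absurd hh (by decide)
    · rw [h1, h1'] at hh; exact absurd hh (by decide)
    · rw [h2, h2', hlo]
  have hh' : H.hi g = H.hi g' := H.pos_injective hhi
  apply H.edgeOf_injective hs
  have lt := H.edgeOf_fst_lt_snd g
  have lt' := H.edgeOf_fst_lt_snd g'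
  rcases H.edgeOf_eq_lo_hi g with he | he <;> rcases H.edgeOf_eq_lo_hi g' with he' | he'
  · rw [he, he', hl, hh']
  · exfalso; rw [he, hl, hh'] at lt; rw [he'] at lt'; exact lt_asymm lt lt'
  · exfalso; rw [he, hl, hh'] at lt; rw [he'] at lt'; exact lt_asymm lt lt'
  · rw [he, he', hl, hh']

/-- A structured vertex is a port or an inner vertex of a gadget with an inner local index.
[cite: BlaserDorflerIkenmeyer2020, Lemma 26, proof (arXiv, TeX L1917–1919; = CCC 2021 Lemma 8.5)] -/
theorem posW_cases (w : H.W) :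
    (∃ v, w = Sum.inl v ∧ H.posW w = scalePos (H.pos v)) ∨
      (∃ j a, a ≠ 0 ∧ a ≠ 6 ∧ w = H.attachEq j a ∧ H.posW w = H.place (Sum.inl j) (H.offEq j a)) ∨
      (∃ j a, a ≠ 0 ∧ a ≠ 7 ∧ w = H.attachNe j a ∧ H.posW w = H.place (Sum.inr j) (H.offNe j a)) := by
  rcases w with v | ⟨⟨j, i⟩⟩ | ⟨⟨j, i⟩⟩
  · exact Or.inl ⟨v, rfl, rfl⟩
  · right; left
    have hw : (Sum.inr (Sum.inl (j, i)) : H.W) = H.attachEq j ⟨i.1 + 1, by omega⟩ :=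
      H.eq_attachEq_of_idxEq (by simp [idxEq])
    refine ⟨j, ⟨i.1 + 1, by omega⟩, ?_, ?_, hw, by rw [hw, posW_attachEq]⟩
    · exact Fin.ne_of_val_ne (by simp)
    · have := i.2; exact Fin.ne_of_val_ne (by simp only [Fin.coe_ofNat_eq_mod]; omega)
  · right; right
    have hw : (Sum.inr (Sum.inr (j, i)) : H.W) = H.attachNe j ⟨i.1 + 1, by omega⟩ :=
      H.eq_attachNe_of_idxNe (by simp [idxNe])
    refine ⟨j, ⟨i.1 + 1, by omega⟩, ?_, ?_, hw, by rw [hw, posW_attachNe]⟩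
    · exact Fin.ne_of_val_ne (by simp)
    · have := i.2; exact Fin.ne_of_val_ne (by simp only [Fin.coe_ofNat_eq_mod]; omega)

/-- **Def. 24 (1) for `G₂`: the embedding is injective** (under the parity mirroring rule).
[cite: BlaserDorflerIkenmeyer2020, Def. 24 (1) and Lemma 26, proof ("replacing all edges in a subgraph of a grid yields a grid-like layered graph") (arXiv, TeX L1667, L1925–1926; = CCC 2021 Def. 8.3, Lemma 8.5)] -/
theorem posW_injective (hs : H.EdgesSimple) : Function.Injective H.posW := by
  intro w w' h
  rcases H.posW_cases w with ⟨v, rfl, hw⟩ | ⟨j, a, ha0, ha6, rfl, hw⟩ | ⟨j, a, ha0, ha7, rfl, hw⟩ <;>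
    rcases H.posW_cases w' with ⟨v', rfl, hw'⟩ | ⟨j', a', ha0', ha6', rfl, hw'⟩ | ⟨j', a', ha0', ha7', rfl, hw'⟩
  · -- port / port
    rw [hw, hw'] at h
    unfold scalePos at h
    rw [Prod.ext_iff] at h
    simp only at h
    have : H.pos v = H.pos v' := Prod.ext (by omega) (by omega)
    rw [H.pos_injective this]
  · rw [hw, hw'] at h
    exact absurd h (H.scalePos_ne_place _ (H.innerOff_offEq j' ha0' ha6'))
  · rw [hw, hw'] at h
    exact absurd h (H.scalePos_ne_place _ (H.innerOff_offNe j' ha0' ha7'))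
  · rw [hw, hw'] at h
    exact absurd h.symm (H.scalePos_ne_place _ (H.innerOff_offEq j ha0 ha6))
  · -- eq inner / eq inner
    rw [hw, hw'] at h
    obtain ⟨hh, hlo, ho⟩ := H.place_eq_place (H.innerOff_offEq j ha0 ha6) (H.innerOff_offEq j' ha0' ha6') h
    have hg := H.gadget_eq_of_lo hs hh hlo
    simp only [Sum.inl.injEq] at hg
    subst hg
    obtain ⟨i1, i2, -, -⟩ := injective_tables
    have : a = a' := by
      unfold offEq at ho; split_ifs at ho
      · exact i1 _ _ ho
      · exact i2 _ _ ho
    rw [this]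
  · rw [hw, hw'] at h
    obtain ⟨hh, hlo, -⟩ := H.place_eq_place (H.innerOff_offEq j ha0 ha6) (H.innerOff_offNe j' ha0' ha7') h
    exact absurd (H.gadget_eq_of_lo hs hh hlo) (by simp)
  · rw [hw, hw'] at h
    exact absurd h.symm (H.scalePos_ne_place _ (H.innerOff_offNe j ha0 ha7))
  · rw [hw, hw'] at h
    obtain ⟨hh, hlo, -⟩ := H.place_eq_place (H.innerOff_offNe j ha0 ha7) (H.innerOff_offEq j' ha0' ha6') h
    exact absurd (H.gadget_eq_of_lo hs hh hlo) (by simp)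
  · -- ne inner / ne inner
    rw [hw, hw'] at h
    obtain ⟨hh, hlo, ho⟩ := H.place_eq_place (H.innerOff_offNe j ha0 ha7) (H.innerOff_offNe j' ha0' ha7') h
    have hg := H.gadget_eq_of_lo hs hh hlo
    simp only [Sum.inr.injEq] at hg
    subst hg
    obtain ⟨-, -, i3, i4⟩ := injective_tables
    have : a = a' := by
      unfold offNe at ho; split_ifs at ho
      · exact i3 _ _ ho
      · exact i4 _ _ ho
    rw [this]

/-! ## Def. 24 (5): no two inter-layer edges cross -/

/-- One orientation instance of the local non-crossing condition (Def. 24 (5) in offset coordinates):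
lower ends strictly left-to-right force upper ends weakly left-to-right.
[cite: BlaserDorflerIkenmeyer2020, Def. 24 (5) and Lemma 25, proof (arXiv, TeX L1673, L1719; = CCC 2021 Def. 8.3, Lemma 8.4)] -/
abbrev NCL (A B C D : ℕ × ℕ) : Prop :=
  B.2 ≠ A.2 + 1 ∨ D.2 ≠ C.2 + 1 ∨ C.2 ≠ A.2 ∨ C.1 ≤ A.1 ∨ B.1 ≤ D.1

/-- All four orientation instances for two unordered local edges. [cite: BlaserDorflerIkenmeyer2020, Def. 24 (5) (arXiv, TeX L1673; = CCC 2021 Def. 8.3)] -/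
abbrev NC (a b c d : ℕ × ℕ) : Prop := NCL a b c d ∧ NCL b a c d ∧ NCL a b d c ∧ NCL b a d c

set_option maxRecDepth 100000 in
set_option synthInstance.maxSize 100000 in
set_option synthInstance.maxHeartbeats 400000 in
/-- The drawn gadgets have no two crossing edges (FILE B's `layerEdgesNonCrossing`, restated on the
offset tables in a reflection-invariant form). [cite: BlaserDorflerIkenmeyer2020, Lemma 26, proof ("all those gadgets are designed as grid-like layered graphs") (arXiv, TeX L1925; = CCC 2021 Lemma 8.5)] -/
private theorem nc_tables :
    (∀ e ∈ eqGadgetH.edges, ∀ f ∈ eqGadgetH.edges, NC (offEqH e.1) (offEqH e.2) (offEqH f.1) (offEqH f.2)) ∧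
    (∀ e ∈ eqGadgetV.edges, ∀ f ∈ eqGadgetV.edges, NC (offEqV e.1) (offEqV e.2) (offEqV f.1) (offEqV f.2)) ∧
    (∀ e ∈ neGadgetH.edges, ∀ f ∈ neGadgetH.edges, NC (offNeH e.1) (offNeH e.2) (offNeH f.1) (offNeH f.2)) ∧
    (∀ e ∈ neGadgetV.edges, ∀ f ∈ neGadgetV.edges, NC (offNeV e.1) (offNeV e.2) (offNeV f.1) (offNeV f.2)) := by
  refine ⟨?_, ?_, ?_, ?_⟩ <;> decide

/-- `NC` is symmetric under reversing either edge. [folklore] -/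
private theorem nc_swap_left {a b c d : ℕ × ℕ} (h : NC a b c d) : NC b a c d :=
  ⟨h.2.1, h.1, h.2.2.2, h.2.2.1⟩

/-- `NC` is symmetric under reversing the second edge. [folklore] -/
private theorem nc_swap_right {a b c d : ℕ × ℕ} (h : NC a b c d) : NC a b d c :=
  ⟨h.2.2.1, h.2.2.2, h.1, h.2.1⟩

/-- Two local edges of one equality gadget do not cross (any orientations).
[cite: BlaserDorflerIkenmeyer2020, Lemma 26, proof (arXiv, TeX L1925; = CCC 2021 Lemma 8.5)] -/
theorem nc_offEq (j : Fin H.numEq) {a b c d : Fin 7}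
    (he : (a, b) ∈ H.edgesEq j ∨ (b, a) ∈ H.edgesEq j) (hf : (c, d) ∈ H.edgesEq j ∨ (d, c) ∈ H.edgesEq j) :
    NC (H.offEq j a) (H.offEq j b) (H.offEq j c) (H.offEq j d) := by
  obtain ⟨t1, t2, -, -⟩ := nc_tables
  have key : ∀ {a b c d : Fin 7}, (a, b) ∈ H.edgesEq j → (c, d) ∈ H.edgesEq j →
      NC (H.offEq j a) (H.offEq j b) (H.offEq j c) (H.offEq j d) := by
    intro a b c d he hf
    unfold edgesEq at he hf; unfold offEq
    split_ifs at he hf ⊢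
    · exact t1 _ he _ hf
    · exact t2 _ he _ hf
  rcases he with he | he <;> rcases hf with hf | hf
  · exact key he hf
  · exact nc_swap_right (key he hf)
  · exact nc_swap_left (key he hf)
  · exact nc_swap_left (nc_swap_right (key he hf))

/-- Two local edges of one inequality gadget do not cross (any orientations).
[cite: BlaserDorflerIkenmeyer2020, Lemma 26, proof (arXiv, TeX L1925; = CCC 2021 Lemma 8.5)] -/
theorem nc_offNe (j : Fin H.numNe) {a b c d : Fin 8}
    (he : (a, b) ∈ H.edgesNe j ∨ (b, a) ∈ H.edgesNe j) (hf : (c, d) ∈ H.edgesNe j ∨ (d, c) ∈ H.edgesNe j) :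
    NC (H.offNe j a) (H.offNe j b) (H.offNe j c) (H.offNe j d) := by
  obtain ⟨-, -, t3, t4⟩ := nc_tables
  have key : ∀ {a b c d : Fin 8}, (a, b) ∈ H.edgesNe j → (c, d) ∈ H.edgesNe j →
      NC (H.offNe j a) (H.offNe j b) (H.offNe j c) (H.offNe j d) := by
    intro a b c d he hf
    unfold edgesNe at he hf; unfold offNe
    split_ifs at he hf ⊢
    · exact t3 _ he _ hf
    · exact t4 _ he _ hf
  rcases he with he | he <;> rcases hf with hf | hf
  · exact key he hf
  · exact nc_swap_right (key he hf)
  · exact nc_swap_left (key he hf)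
  · exact nc_swap_left (nc_swap_right (key he hf))

/-- Offset bounds by orientation. [cite: BlaserDorflerIkenmeyer2020, Lemma 26, Fig. eqneqgadget (arXiv; = CCC 2021 Lemma 8.5)] -/
abbrev OffBounds (g : H.GIdx) (o : ℕ × ℕ) : Prop :=
  o.1 ≤ 4 ∧ o.2 ≤ 4 ∧ ((H.isHor g = true ∧ o.2 ≤ 1) ∨ (H.isHor g = false ∧ o.1 ≤ 1))

set_option maxHeartbeats 1600000 in
/-- **The core of Def. 24 (5) inside ONE gadget (arithmetic):** two placed local edges whose lower ends
lie in one row, strictly ordered, have their upper ends weakly ordered the same way — by the gadget's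
own non-crossing table fact, transported through the (possibly reflecting) placement.
[cite: BlaserDorflerIkenmeyer2020, Def. 24 (5) and Lemma 26, proof (arXiv, TeX L1673, L1925–1926; = CCC 2021 Def. 8.3, Lemma 8.5)] -/
theorem place_noncross_same {g : H.GIdx} {oa ob oa' ob' : ℕ × ℕ}
    (hba : H.OffBounds g oa) (hba' : H.OffBounds g oa')
    (hbb' : H.OffBounds g ob') (hL : LocalOK oa ob) (hL' : LocalOK oa' ob')
    (hNC : NC oa ob oa' ob' ∧ NC oa' ob' oa ob)
    (hv : (H.place g ob).2 = (H.place g oa).2 + 1) (hv' : (H.place g ob').2 = (H.place g oa').2 + 1)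
    (hu : (H.place g oa').2 = (H.place g oa).2) (hx : (H.place g oa).1 < (H.place g oa').1) :
    (H.place g ob).1 ≤ (H.place g ob').1 := by
  have hL1 : oa.2 = ob.2 ∨ ((ob.2 = oa.2 + 1 ∨ oa.2 = ob.2 + 1) ∧ ob.1 ≤ oa.1 + 1 ∧ oa.1 ≤ ob.1 + 1) := by
    by_cases h : oa.2 = ob.2
    · exact Or.inl h
    · exact Or.inr (hL.1 h)
  have hL2 : oa'.2 = ob'.2 ∨
      ((ob'.2 = oa'.2 + 1 ∨ oa'.2 = ob'.2 + 1) ∧ ob'.1 ≤ oa'.1 + 1 ∧ oa'.1 ≤ ob'.1 + 1) := by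
    by_cases h : oa'.2 = ob'.2
    · exact Or.inl h
    · exact Or.inr (hL'.1 h)
  obtain ⟨hnc, hnc'⟩ := hNC
  have i1 : NCL oa ob oa' ob' := hnc.1
  have i2 : NCL oa' ob' oa ob := hnc'.1
  have i3 : NCL ob' oa' ob oa := hnc'.2.2.2
  clear hL hL' hnc hnc'
  unfold NCL at i1 i2 i3
  unfold OffBounds at hba hba' hbb'
  unfold place scalePos parity at hv hv' hu hx ⊢
  cases hh : H.isHor g <;>
    simp only [hh, Bool.false_eq_true, Bool.true_eq_false, false_and, true_and, false_or, or_false,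
      ↓reduceIte] at hba hba' hbb' hv hv' hu hx ⊢ <;>
    split_ifs at hv hv' hu hx ⊢ <;> simp only at hv hv' hu hx ⊢ <;> omega

set_option maxHeartbeats 1600000 in
/-- **The core of Def. 24 (5) across TWO gadgets (arithmetic):** edges have `|Δx| ≤ 1`, so a crossing
would be the two diagonals of a unit square; distinct gadgets of the same orientation are `≥ 4` apart
and cannot both reach it, and a horizontal and a vertical gadget meeting at a corner are kept apart by
the PARITY rule. [cite: BlaserDorflerIkenmeyer2020, Def. 24 (5) and Lemma 26, proof (arXiv, TeX L1673, L1925–1926; the placement rule of registry B47) (= CCC 2021 Def. 8.3, Lemma 8.5)] -/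
theorem place_noncross_distinct {g g' : H.GIdx} {oa ob oa' ob' : ℕ × ℕ}
    (hba : H.OffBounds g oa) (hbb : H.OffBounds g ob) (hba' : H.OffBounds g' oa')
    (hbb' : H.OffBounds g' ob') (hL : LocalOK oa ob) (hL' : LocalOK oa' ob')
    (hd : H.isHor g ≠ H.isHor g' ∨ H.pos (H.lo g) ≠ H.pos (H.lo g'))
    (hv : (H.place g ob).2 = (H.place g oa).2 + 1) (hv' : (H.place g' ob').2 = (H.place g' oa').2 + 1)
    (hu : (H.place g' oa').2 = (H.place g oa).2) (hx : (H.place g oa).1 < (H.place g' oa').1) :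
    (H.place g ob).1 ≤ (H.place g' ob').1 := by
  have hL1 : oa.2 = ob.2 ∨ ((ob.2 = oa.2 + 1 ∨ oa.2 = ob.2 + 1) ∧ ob.1 ≤ oa.1 + 1 ∧ oa.1 ≤ ob.1 + 1) := by
    by_cases h : oa.2 = ob.2
    · exact Or.inl h
    · exact Or.inr (hL.1 h)
  have hL2 : oa'.2 = ob'.2 ∨
      ((ob'.2 = oa'.2 + 1 ∨ oa'.2 = ob'.2 + 1) ∧ ob'.1 ≤ oa'.1 + 1 ∧ oa'.1 ≤ ob'.1 + 1) := by
    by_cases h : oa'.2 = ob'.2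
    · exact Or.inl h
    · exact Or.inr (hL'.1 h)
  clear hL hL'
  simp only [ne_eq, Prod.ext_iff, not_and_or] at hd
  unfold OffBounds at hba hbb hba' hbb'
  unfold place scalePos parity at hv hv' hu hx ⊢
  cases hh : H.isHor g <;> cases hh' : H.isHor g' <;>
    simp only [hh, hh', Bool.false_eq_true, Bool.true_eq_false, false_and, true_and, false_or,
      or_false, ↓reduceIte, not_true_eq_false, not_false_eq_true] at hba hbb hba' hbb' hv hv' hu hx hd ⊢ <;>
    split_ifs at hv hv' hu hx ⊢ <;> simp only at hv hv' hu hx ⊢ <;> omega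

/-- Distinct gadgets differ in orientation or in their lower end. [cite: BlaserDorflerIkenmeyer2020, Lemma 29, proof (arXiv, TeX L2278–2280; = CCC 2021 Lemma 8.8)] -/
theorem dist_of_ne (hs : H.EdgesSimple) {g g' : H.GIdx} (hne : g ≠ g') :
    H.isHor g ≠ H.isHor g' ∨ H.pos (H.lo g) ≠ H.pos (H.lo g') := by
  by_contra h
  simp only [not_or, ne_eq, not_not] at h
  exact hne (H.gadget_eq_of_lo hs h.1 h.2)

/-- Local well-drawnness of an unordered local edge of an equality gadget. [cite: BlaserDorflerIkenmeyer2020, Lemma 26, proof (arXiv, TeX L1925; = CCC 2021 Lemma 8.5)] -/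
theorem localOK_offEq' (j : Fin H.numEq) {a b : Fin 7}
    (h : (a, b) ∈ H.edgesEq j ∨ (b, a) ∈ H.edgesEq j) : LocalOK (H.offEq j a) (H.offEq j b) := by
  rcases h with h | h
  · exact H.localOK_offEq j h
  · exact localOK_symm (H.localOK_offEq j h)

/-- Local well-drawnness of an unordered local edge of an inequality gadget. [cite: BlaserDorflerIkenmeyer2020, Lemma 26, proof (arXiv, TeX L1925; = CCC 2021 Lemma 8.5)] -/
theorem localOK_offNe' (j : Fin H.numNe) {a b : Fin 8}
    (h : (a, b) ∈ H.edgesNe j ∨ (b, a) ∈ H.edgesNe j) : LocalOK (H.offNe j a) (H.offNe j b) := by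
  rcases h with h | h
  · exact H.localOK_offNe j h
  · exact localOK_symm (H.localOK_offNe j h)

/-- **Def. 24 (5) for `G₂`: inter-layer edges do not cross** — two edges from one row to the next
whose lower ends are strictly ordered left to right have their upper ends weakly ordered the same way.
[cite: BlaserDorflerIkenmeyer2020, Def. 24 (5) and Lemma 26, proof ("replacing all edges in a subgraph of a grid yields a grid-like layered graph") (arXiv, TeX L1673, L1925–1926; = CCC 2021 Def. 8.3, Lemma 8.5)] -/
theorem noncrossing_W (hs : H.EdgesSimple) {u v u' v' : H.W} (h1 : 0 < H.mult u v)
    (h2 : 0 < H.mult u' v') (hv : (H.posW v).2 = (H.posW u).2 + 1)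
    (hv' : (H.posW v').2 = (H.posW u').2 + 1) (hu : (H.posW u').2 = (H.posW u).2)
    (hx : (H.posW u).1 < (H.posW u').1) : (H.posW v).1 ≤ (H.posW v').1 := by
  rcases H.exists_attach_of_mult_pos h1 with ⟨j, a, b, rfl, rfl, hab⟩ | ⟨j, a, b, rfl, rfl, hab⟩ <;>
    rcases H.exists_attach_of_mult_pos h2 with
      ⟨j', a', b', rfl, rfl, hab'⟩ | ⟨j', a', b', rfl, rfl, hab'⟩
  · -- eq / eq
    simp only [posW_attachEq] at hv hv' hu hx ⊢
    have he := (H.multEq_pos_iff j a b).1 hab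
    have he' := (H.multEq_pos_iff j' a' b').1 hab'
    by_cases hjj : j = j'
    · subst hjj
      exact H.place_noncross_same (H.bounds_offEq j a) (H.bounds_offEq j a') (H.bounds_offEq j b')
        (H.localOK_offEq' j he) (H.localOK_offEq' j he') ⟨H.nc_offEq j he he', H.nc_offEq j he' he⟩
        hv hv' hu hx
    · exact H.place_noncross_distinct (H.bounds_offEq j a) (H.bounds_offEq j b) (H.bounds_offEq j' a')
        (H.bounds_offEq j' b') (H.localOK_offEq' j he) (H.localOK_offEq' j' he')
        (H.dist_of_ne hs (fun h => hjj (Sum.inl.inj h))) hv hv' hu hx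
  · -- eq / ne
    rw [posW_attachEq, posW_attachEq] at hv
    rw [posW_attachNe, posW_attachNe] at hv'
    rw [posW_attachNe, posW_attachEq] at hu hx
    rw [posW_attachEq, posW_attachNe]
    have he := (H.multEq_pos_iff j a b).1 hab
    have he' := (H.multNe_pos_iff j' a' b').1 hab'
    exact H.place_noncross_distinct (H.bounds_offEq j a) (H.bounds_offEq j b) (H.bounds_offNe j' a')
      (H.bounds_offNe j' b') (H.localOK_offEq' j he) (H.localOK_offNe' j' he')
      (H.dist_of_ne hs (by simp)) hv hv' hu hx
  · -- ne / eq
    rw [posW_attachNe, posW_attachNe] at hv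
    rw [posW_attachEq, posW_attachEq] at hv'
    rw [posW_attachEq, posW_attachNe] at hu hx
    rw [posW_attachNe, posW_attachEq]
    have he := (H.multNe_pos_iff j a b).1 hab
    have he' := (H.multEq_pos_iff j' a' b').1 hab'
    exact H.place_noncross_distinct (H.bounds_offNe j a) (H.bounds_offNe j b) (H.bounds_offEq j' a')
      (H.bounds_offEq j' b') (H.localOK_offNe' j he) (H.localOK_offEq' j' he')
      (H.dist_of_ne hs (by simp)) hv hv' hu hx
  · -- ne / ne
    simp only [posW_attachNe] at hv hv' hu hx ⊢
    have he := (H.multNe_pos_iff j a b).1 hab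
    have he' := (H.multNe_pos_iff j' a' b').1 hab'
    by_cases hjj : j = j'
    · subst hjj
      exact H.place_noncross_same (H.bounds_offNe j a) (H.bounds_offNe j a') (H.bounds_offNe j b')
        (H.localOK_offNe' j he) (H.localOK_offNe' j he') ⟨H.nc_offNe j he he', H.nc_offNe j he' he⟩
        hv hv' hu hx
    · exact H.place_noncross_distinct (H.bounds_offNe j a) (H.bounds_offNe j b) (H.bounds_offNe j' a')
        (H.bounds_offNe j' b') (H.localOK_offNe' j he) (H.localOK_offNe' j' he')
        (H.dist_of_ne hs (fun h => hjj (Sum.inr.inj h))) hv hv' hu hx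

/-! ## Packaging: Lemma 29's `G₂` as a grid-like layered multigraph in FILE A's vocabulary -/

/-- **`regularise H` — Lemma 29's graph `G₂`** on the vertex set `Fin card₂`, as a grid-like layered
multigraph in the sense of Def. 24 (`GridLikeLayered`, FILE A): positions `pos₂` (parity mirroring
placement), multiplicities `mult₂` (the `8`-regular gadget versions with the port allocation); the six
Def-24 fields are `posW_injective`, `adj_geometry_W`, `noncrossing_W`, `exists_inter_W` transported
along `wEquiv`. Hypotheses: no isolated vertex, no doubly-labelled edge.
[cite: BlaserDorflerIkenmeyer2020, Lemma 29, proof ("the `8`-regular grid-like layered graph `G_2`") and Lemma 26, proof ("replacing all edges in a subgraph of a grid yields a grid-like layered graph … make the graph `8`-regular") (arXiv, TeX L2278–2283, L1925–1932; = CCC 2021 Lemmas 8.8, 8.5)] -/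
def regularise (hiso : H.NoIsolated) (hs : H.EdgesSimple) : GridLikeLayered H.card₂ where
  pos := H.pos₂
  mult := H.mult₂
  mult_comm a b := H.mult_comm _ _
  mult_self a := H.mult_self _
  pos_injective := fun _ _ h => H.wEquiv.injective (H.posW_injective hs h)
  inter_adj _ _ h hne := (H.adj_geometry_W h).1 hne
  intra_adj _ _ h heq := (H.adj_geometry_W h).2 heq
  noncrossing _ _ _ _ h1 h2 hv hv' hu hx := H.noncrossing_W hs h1 h2 hv hv' hu hx
  exists_inter u := by
    obtain ⟨w', h, hne⟩ := H.exists_inter_W hiso (H.wEquiv u)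
    refine ⟨H.wEquiv.symm w', ?_, ?_⟩
    · simpa [mult₂] using h
    · simpa [pos₂] using hne

/-- The positions of `regularise H` are the closed-form `pos₂`. [cite: BlaserDorflerIkenmeyer2020, Lemma 26, proof (arXiv, TeX L1925–1926; = CCC 2021 Lemma 8.5)] -/
@[simp] theorem regularise_pos (hiso : H.NoIsolated) (hs : H.EdgesSimple) :
    (H.regularise hiso hs).pos = H.pos₂ := rfl

/-- The multiplicities of `regularise H` are the closed-form `mult₂`. [cite: BlaserDorflerIkenmeyer2020, Lemma 26, proof (arXiv, TeX L1927–1932; = CCC 2021 Lemma 8.5)] -/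
@[simp] theorem regularise_mult (hiso : H.NoIsolated) (hs : H.EdgesSimple) :
    (H.regularise hiso hs).mult = H.mult₂ := rfl

/-- ★ **Lemma 29 (i): `G₂` is `8`-regular.** [cite: BlaserDorflerIkenmeyer2020, Lemma 29, proof ("the `8`-regular grid-like layered graph `G_2`") (arXiv, TeX L2281; = CCC 2021 Lemma 8.8)] -/
theorem regularise_isRegular (hiso : H.NoIsolated) (hs : H.EdgesSimple) :
    (H.regularise hiso hs).IsRegular 8 :=
  fun v => H.sum_mult₂_eq_eight hiso hs v

/-- ★ **Lemma 29 (ii): `G₂` is properly `3`-colourable iff `H` is relationally `3`-colourable** ("we can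
decide via this reduction whether `G` allows for a relational `3`-coloring").
[cite: BlaserDorflerIkenmeyer2020, Lemma 29, proof (arXiv, TeX L2282–2283; = CCC 2021 Lemma 8.8)] -/
theorem regularise_isProper3_iff (hiso : H.NoIsolated) (hs : H.EdgesSimple) :
    (∃ c, (H.regularise hiso hs).IsProper3 c) ↔ H.IsRelColourable :=
  H.exists_proper_mult₂_iff

-- Lemma 29 (iii), the linear size bound `card₂ ≤ 13 · N`, is `card₂_le` of part 1.

/-! ## Parametric transport (RULING (126), x6 g8's interface ask): the same graph along ANY explicit
enumeration of the structured vertices — the closer picks the numbering it mirrors on codes -/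

/-- **`regulariseAlong e` — Lemma 29's `G₂` numbered by an arbitrary bijection `e : Fin n ≃ W`**
(positions `posW ∘ e`, multiplicities `mult` on `e`-images); `regularise = regulariseAlong wEquiv`.
All Def-24 fields transfer along `e`.
[cite: BlaserDorflerIkenmeyer2020, Lemma 29, proof ("the `8`-regular grid-like layered graph `G_2`") (arXiv, TeX L2278–2283; = CCC 2021 Lemma 8.8)] -/
def regulariseAlong (hiso : H.NoIsolated) (hs : H.EdgesSimple) {n : ℕ} (e : Fin n ≃ H.W) :
    GridLikeLayered n where
  pos a := H.posW (e a)
  mult a b := H.mult (e a) (e b)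
  mult_comm _ _ := H.mult_comm _ _
  mult_self _ := H.mult_self _
  pos_injective := fun _ _ h => e.injective (H.posW_injective hs h)
  inter_adj _ _ h hne := (H.adj_geometry_W h).1 hne
  intra_adj _ _ h heq := (H.adj_geometry_W h).2 heq
  noncrossing _ _ _ _ h1 h2 hv hv' hu hx := H.noncrossing_W hs h1 h2 hv hv' hu hx
  exists_inter u := by
    obtain ⟨w', h, hne⟩ := H.exists_inter_W hiso (e u)
    refine ⟨e.symm w', ?_, ?_⟩
    · simpa using h
    · simpa using hne

/-- Positions of `regulariseAlong e` (closed form `posW` along `e`). [cite: BlaserDorflerIkenmeyer2020, Lemma 26, proof (arXiv, TeX L1925–1926; = CCC 2021 Lemma 8.5)] -/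
@[simp] theorem regulariseAlong_pos (hiso : H.NoIsolated) (hs : H.EdgesSimple) {n : ℕ}
    (e : Fin n ≃ H.W) (a : Fin n) : (H.regulariseAlong hiso hs e).pos a = H.posW (e a) := rfl

/-- Multiplicities of `regulariseAlong e` (closed form `mult` along `e`). [cite: BlaserDorflerIkenmeyer2020, Lemma 26, proof (arXiv, TeX L1927–1932; = CCC 2021 Lemma 8.5)] -/
@[simp] theorem regulariseAlong_mult (hiso : H.NoIsolated) (hs : H.EdgesSimple) {n : ℕ}
    (e : Fin n ≃ H.W) (a b : Fin n) : (H.regulariseAlong hiso hs e).mult a b = H.mult (e a) (e b) := rfl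

/-- `regularise` is `regulariseAlong` the closed-form enumeration `wEquiv`. [cite: BlaserDorflerIkenmeyer2020, Lemma 29, proof (arXiv, TeX L2278–2283; = CCC 2021 Lemma 8.8)] -/
theorem regularise_eq_regulariseAlong (hiso : H.NoIsolated) (hs : H.EdgesSimple) :
    H.regularise hiso hs = H.regulariseAlong hiso hs H.wEquiv := rfl

/-- ★ **Lemma 29 (i) along any enumeration: `8`-regular.** [cite: BlaserDorflerIkenmeyer2020, Lemma 29, proof (arXiv, TeX L2281; = CCC 2021 Lemma 8.8)] -/
theorem regulariseAlong_isRegular (hiso : H.NoIsolated) (hs : H.EdgesSimple) {n : ℕ}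
    (e : Fin n ≃ H.W) : (H.regulariseAlong hiso hs e).IsRegular 8 := by
  intro v
  show (∑ w, H.mult (e v) (e w)) = 8
  rw [← H.degW_eq_eight hiso hs (e v)]
  unfold degW
  exact Fintype.sum_equiv e _ _ fun _ => rfl

/-- ★ **Lemma 29 (ii) along any enumeration: properly `3`-colourable iff `H` is relationally
`3`-colourable.** [cite: BlaserDorflerIkenmeyer2020, Lemma 29, proof (arXiv, TeX L2282–2283; = CCC 2021 Lemma 8.8)] -/
theorem regulariseAlong_isProper3_iff (hiso : H.NoIsolated) (hs : H.EdgesSimple) {n : ℕ}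
    (e : Fin n ≃ H.W) : (∃ c, (H.regulariseAlong hiso hs e).IsProper3 c) ↔ H.IsRelColourable := by
  rw [← H.exists_isProperW_iff]
  constructor
  · rintro ⟨c, hc⟩
    refine ⟨fun w => c (e.symm w), fun w w' h => hc _ _ ?_⟩
    show 0 < H.mult (e (e.symm w)) (e (e.symm w'))
    simpa using h
  · rintro ⟨c, hc⟩
    exact ⟨fun a => c (e a), fun a b h => hc _ _ h⟩

end RelGridGraph

end BDI2020

end Literature.Computability.AlgebraicComplexity
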